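import Literature.NumberTheory.Rogawski1990.ArchOrbFamGExtWallDescentDress      -- ★ p851164 (this seat): `exists_wallDescent_dress` (the `hdesc₁` of the box descent ★ p851016)
import Literature.NumberTheory.Rogawski1990.ArchOrbFamGExtFaceJetModel         -- ★ p851091∕p851119 (this seat): `exists_nhds_bddAbove_norm_iteratedFDeriv_orbFamGExt_of_wallDescent'`
import Literature.NumberTheory.Automorphic.ArchRankOneCasimirUniformFamilyCayley -- ★ p851142 (this seat): `hbd` in the `U(J)` Cayley frame
import Literature.NumberTheory.Automorphic.ArchRankOneOrbitalFamilyParamCayley -- ★ p851143 (F0P3a-p04 (g24)) (B-par) Cayley edition: `contDiffOn_cayley_orbitalIntegral_param`, `fderiv_cayley_orbitalIntegral_param_prod_apply`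
import Literature.NumberTheory.Rogawski1990.ArchTransfFamilyJumpKit            -- ★ `slotSign_zero_ne_two_of_mem_splitChartPlaces`
import HarnessLib

/-!
# (I₁) AT THE FACES, CUT 1 — HYPOTHESIS-FREE: bounded jets of `orbFamGExt` near every semiregular point of the noncompact wall `(w₀, 0, 2)` at a split-chart place
# (Harish-Chandra ∕ Varadarajan 1977 I §1.12; Bouaziz 1994 §3.1 (I₁)–(I₂); Shelstad 1979 §4; Rogawski 1990 §8.2)

Topic `NumberTheory/Rogawski1990`; namespace `Literature.NumberTheory.Rogawski1990`.  THEOREMS ONLY (no `def`, no instance, no notation, no axiom, no named fact, no `sorry`).  Cell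
`pub/hodgecm-mathlib`, crux H413 (`stmt-HodgeConjecture-24833`), F0∕P3c line LH3 (closer stub `stub_N9`, DIRECT ROAD), LETTER L1 clause (I₁): the FACE-LEVEL INSTANTIATION (ii) of
(I₁) spec-owner LH7-p04 (g4)'s deal 2026-09-02T10:45:11Z — the `hF` socket of ★ (I₁-asm) `smoothBounded_orbFamGExt_of_strata` DISCHARGED at the `HcSemireg` base points of the wall
`(w₀, 0, 2)`, `w₀` a split-chart place (CUT 1: exactly the points ★ (B-desc) box p851016 descends; CUT 2 = general one-wall points via (B-desc′) and general pairs via (B-rel), same head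
through ★ `…_of_wallDescent_oneWall`).  Seat LH3-p02 (g4).  Count-neutral.

THE ASSEMBLY (nothing re-typed; every input ★): the Cayley `U(J)` functional `F` at centre `1` on the shared-datum carrier (`hJ`, a two-sided Haar `μ₀`); `hdesc₁` = ★ `exists_wallDescent_dress`
(this seat; the box descent in FILE 2b's tokens, `ce = 2cos`); the admissible class `Adm Θ := ContDiff ℝ ∞ (uncurry Θ) ∧ ∃ C compact, Θ = 0 off C` with the transversal derivative
`D v Θ q X := ∂_v (q′ ↦ Θ q′ X) q` (closed: ★ `contDiff_uncurry_fderiv_apply`, ★ `forall_fderiv_apply_eq_zero_of_support`, F0P3a-p04); reader clauses `h1₁`∕`h2₁` on `Q ×ˢ {sin ψ ≠ 0}`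
= ★ (B-par) Cayley edition `contDiffOn_cayley_orbitalIntegral_param` ∕ `fderiv_cayley_orbitalIntegral_param_prod_apply` (p851143); the (I₁) input `hbd` = ★
`exists_forall_eventually_norm_iteratedDeriv_orbitalIntegral_cayley_le_of_contDiff_family_of_eq_over` (p851142, frame witness `(L, w₀)`); head ★
`exists_nhds_bddAbove_norm_iteratedFDeriv_orbFamGExt_of_wallDescent'` (p851119).
* **`exists_nhds_bddAbove_norm_iteratedFDeriv_orbFamGExt_of_hcSemireg (hα hreal hJ [inst] μ₀ hS hw₀ hwsp) (hp : HcSemireg S w₀ 0 2 p) (ha′) (n) :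
  ∃ U ∈ 𝓝 p, BddAbove (‖Dⁿ(orbFamGExt ν′ a′ S)‖ '' (U ∩ InRegG (slotSign α) S))`**.
HONEST LABEL: CUT 1 only ((F₀) points of the walls `(w₀,0,2)`); (F)∖(F₀), other pairs, (X) and (B3) are other bricks; HC_CM is proved only modulo the 7 printed citations (2 remaining:
hLiu418 = `stmt-HodgeConjecture-24832`, h413 = `stmt-HodgeConjecture-24833`) until rung 0 closes; this file moves no row of the books.

## References
* [Varadarajan1977] V. S. Varadarajan, *Harmonic Analysis on Real Reductive Groups*, LNM 576 (1977), Part I §1.12.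
* [Bouaziz1994IntegralesOrbitales] A. Bouaziz, *Intégrales orbitales sur les groupes de Lie réductifs*, Ann. Sci. ÉNS 27 (1994), §3.1 (I₁)–(I₂) p. 579, §3.2 p. 580.
* [Shelstad1979] D. Shelstad, *Characters and inner forms of a quasi-split group over ℝ*, Compositio Math. 39 (1979), §4 pp. 22–25.
* [Rogawski1990] J. D. Rogawski, *Automorphic Representations of Unitary Groups in Three Variables*, Ann. of Math. Stud. 123 (1990), §8.2 pp. 118–124.
-/

set_option autoImplicit false

noncomputable section

open Set Filter Topology Function MeasureTheory NumberField NumberField.InfinitePlace Complex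
open scoped ContDiff MatrixGroups Matrix Classical Real Matrix.Norms.Operator

namespace Literature.NumberTheory.Rogawski1990

open Literature.NumberTheory.Automorphic Literature.NumberTheory.Automorphic.UnitaryGroup Literature.NumberTheory.Automorphic.ArchCartan
open Literature.Analysis.Calculus

variable (L : Type) [Field L] [NumberField L] [IsCMField L] (α : Fin 3 → L)
  [MeasurableSpace ↥(arch (↥(maximalRealSubfield L)) L (IsCMField.complexConj L) 3 (Matrix.diagonal α))]
  [BorelSpace ↥(arch (↥(maximalRealSubfield L)) L (IsCMField.complexConj L) 3 (Matrix.diagonal α))]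
  (ν' : Measure ↥(arch (↥(maximalRealSubfield L)) L (IsCMField.complexConj L) 3 (Matrix.diagonal α))) [ν'.IsHaarMeasure] [ν'.IsMulRightInvariant]

/-- **(I₁) AT THE FACES OF THE WALL `(w₀, 0, 2)`, HYPOTHESIS-FREE (CUT 1: split-chart place `w₀ ∉ S`, semiregular base points).**  For the genuine family `orbFamGExt ν′ a′ S` of every
`a′ ∈ C_c^∞(G′_∞)` (diagonal frame `hα`, `hreal`; admissible `S`; a split-chart place `w₀ ∉ S`), every semiregular point `p` of the noncompact wall `(w₀, 0, 2)` and every order `n`: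
`∃ U ∈ 𝓝 p, BddAbove (‖Dⁿ(orbFamGExt ν′ a′ S)‖ '' (U ∩ InRegG (slotSign α) S))` — the `hF` socket of ★ (I₁-asm) `smoothBounded_orbFamGExt_of_strata` (LH7-p04) at `HcSemireg` base points.
ASSEMBLY (nothing re-typed): the Cayley `U(J)` functional `F` at centre `1` on the shared-datum carrier (`hJ`, any two-sided Haar `μ₀`; only its EXISTENCE is used — `U(J)` has one);
`hdesc₁` = ★ `exists_wallDescent_dress` (the ★ (B-desc) box p851016 in FILE 2b's tokens); the admissible class `Adm Θ := ContDiff ℝ ∞ (uncurry Θ) ∧ ∃ C compact, Θ q X = 0 off C`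
with `D v Θ q X := ∂_v (q′ ↦ Θ q′ X) q` (closed: ★ `contDiff_uncurry_fderiv_apply`, ★ `forall_fderiv_apply_eq_zero_of_support`); `h1₁`∕`h2₁` = ★ (B-par) Cayley edition
`contDiffOn_cayley_orbitalIntegral_param` ∕ `fderiv_cayley_orbitalIntegral_param_prod_apply` on `Q ×ˢ {sin ψ ≠ 0}`; `hbd` = ★ `…orbitalIntegral_cayley_le_of_contDiff_family_of_eq_over`
(frame witness `(L, w₀)`); head ★ `exists_nhds_bddAbove_norm_iteratedFDeriv_orbFamGExt_of_wallDescent'`.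
[cite: Varadarajan1977, Part I §1.12] [cite: Bouaziz1994IntegralesOrbitales, §3.1 (I₁)–(I₂) p. 579; §3.2 p. 580] [cite: Shelstad1979, §4 pp. 22–25] [cite: Rogawski1990, §8.2 pp. 118–124] -/
theorem exists_nhds_bddAbove_norm_iteratedFDeriv_orbFamGExt_of_hcSemireg (hα : ∀ i, α i ≠ 0)
    (hreal : ∀ (w : {w : InfinitePlace L // IsComplex w}) (i : Fin 3), (w.1.embedding (α i)).im = 0)
    {J : Matrix (Fin 2) (Fin 2) ℂ} (hJ : J = (StdForm.antidiagonal 2).over ℂ)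
    [MeasurableSpace ↥(unitaryGroupOfForm (starRingEnd ℂ) J)] [BorelSpace ↥(unitaryGroupOfForm (starRingEnd ℂ) J)]
    [LocallyCompactSpace ↥(unitaryGroupOfForm (starRingEnd ℂ) J)] [SecondCountableTopology ↥(unitaryGroupOfForm (starRingEnd ℂ) J)]
    (μ₀ : Measure ↥(unitaryGroupOfForm (starRingEnd ℂ) J)) [μ₀.IsHaarMeasure] [μ₀.IsMulRightInvariant]
    {S : Finset {w : InfinitePlace L // IsComplex w}} {w₀ : {w : InfinitePlace L // IsComplex w}} {p : {w : InfinitePlace L // IsComplex w} → Fin 3 → ℝ}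
    (hS : ∀ w, w ∈ S → w ∈ splitChartPlaces L α) (hw₀ : w₀ ∉ S) (hwsp : w₀ ∈ splitChartPlaces L α) (hp : HcSemireg S w₀ 0 2 p)
    {a' : ↥(arch (↥(maximalRealSubfield L)) L (IsCMField.complexConj L) 3 (Matrix.diagonal α)) → ℂ} (ha' : ArchSmooth L 3 (Matrix.diagonal α) a') (n : ℕ) :
    ∃ U ∈ 𝓝 p, BddAbove ((fun c => ‖iteratedFDeriv ℝ n (orbFamGExt L α ν' a' S) c‖) '' (U ∩ InRegG (slotSign L α) S)) := by
  -- the Cayley functional at centre `1`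
  obtain ⟨F, hF⟩ : ∃ F : (Matrix (Fin 2) (Fin 2) ℂ → ℂ) → ℝ → ℂ, ∀ (g : Matrix (Fin 2) (Fin 2) ℂ → ℂ) (ψ : ℝ), F g ψ = (2 * Real.sin ψ) •
      ∫ h : ↥(unitaryGroupOfForm (starRingEnd ℂ) J), g (((h * (⟨(Matrix.GeneralLinearGroup.mkOfDetNeZero !![(1 : ℂ), 1; 1, -1] det_cayleyTwo_ne_zero) * circleDiagonal 2 ![1 * Circle.exp ψ, 1 * Circle.exp (-ψ)] * ((Matrix.GeneralLinearGroup.mkOfDetNeZero !![(1 : ℂ), 1; 1, -1] det_cayleyTwo_ne_zero))⁻¹, cayley_conj_circleDiagonal_mem_of_eq_over hJ _⟩ : ↥(unitaryGroupOfForm (starRingEnd ℂ) J)) * h⁻¹ : ↥(unitaryGroupOfForm (starRingEnd ℂ) J)) : GL (Fin 2) ℂ) : Matrix (Fin 2) (Fin 2) ℂ) ∂μ₀ :=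
    ⟨fun g ψ => _, fun _ _ => rfl⟩
  -- the dress of the box descent
  obtain ⟨K₁, U₁, g, Pf, Ef, -, hU₁o, hpU₁, hgs, hgC, hPf, hEf, -, -, hdesc⟩ := exists_wallDescent_dress L α ν' hα hreal hJ μ₀ hS hw₀ hwsp hp ha' F hF
  -- the admissible class and its transversal derivatives
  set Adm : (({w : InfinitePlace L // IsComplex w} → Fin 3 → ℝ) → Matrix (Fin 2) (Fin 2) ℂ → ℂ) → Prop := fun Θ =>
    ContDiff ℝ ∞ (uncurry Θ) ∧ ∃ C : Set (Matrix (Fin 2) (Fin 2) ℂ), IsCompact C ∧ ∀ q X, X ∉ C → Θ q X = 0 with hAdm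
  set D : ({w : InfinitePlace L // IsComplex w} → Fin 3 → ℝ) → (({w : InfinitePlace L // IsComplex w} → Fin 3 → ℝ) → Matrix (Fin 2) (Fin 2) ℂ → ℂ) →
      (({w : InfinitePlace L // IsComplex w} → Fin 3 → ℝ) → Matrix (Fin 2) (Fin 2) ℂ → ℂ) := fun v Θ q X => fderiv ℝ (fun q' => Θ q' X) q v with hD
  have hcl : ∀ Θ, Adm Θ → ∀ v, Adm (D v Θ) := by
    rintro Θ ⟨hΘ, C, hC, hΘC⟩ v
    exact ⟨contDiff_uncurry_fderiv_apply hΘ v, C, hC, forall_fderiv_apply_eq_zero_of_support hΘC v⟩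
  have hg : Adm g := ⟨hgs, hgC⟩
  -- the reader clauses on `Q ×ˢ {sin ψ ≠ 0}`
  have hT₁ : IsOpen {ψ : ℝ | Real.sin ψ ≠ 0} := isOpen_ne_fun Real.continuous_sin continuous_const
  have hray : ∀ᶠ t : ℝ in 𝓝[≠] 0, t ∈ {ψ : ℝ | Real.sin ψ ≠ 0} := by
    have h : Ioo (-Real.pi) Real.pi ∩ {(0 : ℝ)}ᶜ ∈ 𝓝[≠] (0 : ℝ) :=
      inter_mem (mem_nhdsWithin_of_mem_nhds (Ioo_mem_nhds (neg_lt_zero.2 Real.pi_pos) Real.pi_pos)) self_mem_nhdsWithin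
    filter_upwards [h] with t ht
    rcases lt_or_gt_of_ne (show t ≠ 0 from ht.2) with hlt | hgt
    · exact (Real.sin_neg_of_neg_of_neg_pi_lt hlt ht.1.1).ne
    · exact (Real.sin_pos_of_pos_of_lt_pi hgt ht.1.2).ne'
  have hQo : IsOpen {q : {w : InfinitePlace L // IsComplex w} → Fin 3 → ℝ | ∀ w' ∈ S, w' ≠ w₀ → q w' 0 ≠ 0} := isOpen_setOf_forall_mem_apply_ne_zero S w₀
  have hpQ : p ∈ {q : {w : InfinitePlace L // IsComplex w} → Fin 3 → ℝ | ∀ w' ∈ S, w' ≠ w₀ → q w' 0 ≠ 0} := fun w' hw' _ => hp.2.2.2 w' hw'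
  have h1 : ∀ Θ, Adm Θ → ContDiffOn ℝ ∞ (fun z : ({w : InfinitePlace L // IsComplex w} → Fin 3 → ℝ) × ℝ => F (Θ z.1) z.2)
      ({q : {w : InfinitePlace L // IsComplex w} → Fin 3 → ℝ | ∀ w' ∈ S, w' ≠ w₀ → q w' 0 ≠ 0} ×ˢ {ψ : ℝ | Real.sin ψ ≠ 0}) := by
    rintro Θ ⟨hΘ, hΘC⟩
    exact (contDiffOn_cayley_orbitalIntegral_param hJ μ₀ 1 F hF Θ hΘ hΘC).mono (prod_mono (subset_univ _) le_rfl)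
  have h2 : ∀ Θ, Adm Θ → ∀ (v : {w : InfinitePlace L // IsComplex w} → Fin 3 → ℝ) (z : ({w : InfinitePlace L // IsComplex w} → Fin 3 → ℝ) × ℝ),
      z ∈ {q : {w : InfinitePlace L // IsComplex w} → Fin 3 → ℝ | ∀ w' ∈ S, w' ≠ w₀ → q w' 0 ≠ 0} ×ˢ {ψ : ℝ | Real.sin ψ ≠ 0} →
      fderiv ℝ (fun z : ({w : InfinitePlace L // IsComplex w} → Fin 3 → ℝ) × ℝ => F (Θ z.1) z.2) z (v, 0) = F (D v Θ z.1) z.2 := by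
    rintro Θ ⟨hΘ, hΘC⟩ v z hz
    exact fderiv_cayley_orbitalIntegral_param_prod_apply hJ μ₀ 1 F hF Θ hΘ hΘC v hz.2
  -- the (I₁) input: uniform punctured bounds over compact smooth families (frame witness `(L, w₀)`)
  have hbd : ∀ Θ, Adm Θ → ∀ (a : ℕ) (K : Set ({w : InfinitePlace L // IsComplex w} → Fin 3 → ℝ)), IsCompact K →
      K ⊆ {q : {w : InfinitePlace L // IsComplex w} → Fin 3 → ℝ | ∀ w' ∈ S, w' ≠ w₀ → q w' 0 ≠ 0} →
      ∃ B : ℝ, ∀ᶠ ψ in 𝓝[≠] (0 : ℝ), ∀ q ∈ K, ‖iteratedDeriv a (F (Θ q)) ψ‖ ≤ B := by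
    rintro Θ ⟨hΘ, C, hC, hΘC⟩ a K hK -
    exact exists_forall_eventually_norm_iteratedDeriv_orbitalIntegral_cayley_le_of_contDiff_family_of_eq_over L w₀ hJ μ₀ 1 F hF hK Θ hΘ hC hΘC a
  -- the cofactor `2cos` and the head
  have hce : ContDiff ℝ ∞ fun ν : ℝ => ((2 * Real.cos ν : ℝ) : ℂ) := Complex.ofRealCLM.contDiff.comp (contDiff_const.mul Real.contDiff_cos)
  obtain ⟨hs02, -⟩ := slotSign_zero_ne_two_of_mem_splitChartPlaces L α hα hwsp
  exact exists_nhds_bddAbove_norm_iteratedFDeriv_orbFamGExt_of_wallDescent' L α ν' a' S hw₀ (show (0 : Fin 3) ≠ 2 by decide) hs02 hp F hT₁ hray Adm D hcl hQo hpQ h1 h2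
    g hg Pf Ef hPf hEf (fun ν : ℝ => ((2 * Real.cos ν : ℝ) : ℂ)) hce K₁ hU₁o hpU₁ (fun c hc hT => hdesc c hc fun h0 => by rw [h0] at hT; exact hT Real.sin_zero) hbd n

/-! ## EDITION 2 — CUT 2: the same bound at a NON-GENERIC one-wall base point, from a (B-desc′) box package (LH3-plan (g4) RULING #18 O-L1c; (H-core) LH5-p02 (g4) → (B-desc′) ED. 2) -/

/-- **(I₁) AT THE FACES OF THE WALL `(w₀, 0, 2)` FROM A (B-desc′) BOX PACKAGE (CUT 2: non-generic one-wall base points).**  Let `p` be a one-wall point of the noncompact wall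
`(w₀, 0, 2)` in the sense of the `hF` socket of ★ (I₁-asm) `smoothBounded_orbFamGExt_of_strata` (LH7-p04 (g4)): `p w₀ 0 = p w₀ 2`, the third eigenvalue off (`hxk`), and at every
other compact-chart place no noncompact coincidence (`hxin`; compact coincidences and anything at the split places allowed), `w₀ ∉ S` with `slotSign w₀ 0 ≠ slotSign w₀ 2`.  IF the
extended family admits around `p` a (B-desc′) box package — the eight-clause conclusion of ★ `exists_descent_box_orbFamGExt_inRegG_of_core[Package]` (p851168) VERBATIM (`hpack`;
hypothesis-free once (H-core) lands as (B-desc′) EDITION 2) — then for every order `n`: `∃ U ∈ 𝓝 p, BddAbove (‖Dⁿ(orbFamGExt ν′ a′ S)‖ '' (U ∩ InRegG (slotSign α) S))`.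
ASSEMBLY = EDITION 1's with three substitutions: `hdesc₁` := ★ `exists_wallDescent_dress_of_boxPackage` (ED. 2 of the dress; cofactors globally smooth, so `Q := univ`), the base
point enters only the head ★ `exists_nhds_bddAbove_norm_iteratedFDeriv_orbFamGExt_of_wallDescent_oneWall` (one-wall `InRegG ⇔ off-the-wall` near `p`), and `T₁ := {sin ≠ 0}` is
consumed as is (`sin ν ≠ 0` is the dress's off-wall condition).  `h1₁`∕`h2₁` ★ p851143, `hbd` ★ p851142 (frame witness `(L, w₀)`), `Adm`∕`D` closed by ★ p851003 — unchanged.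
[cite: Varadarajan1977, Part I §1.12] [cite: Bouaziz1994IntegralesOrbitales, §3.1 (I₁)–(I₂) p. 579; §3.2 p. 580] [cite: Shelstad1979, §4 pp. 22–25] [cite: Rogawski1990, §8.2 pp. 118–124] -/
theorem exists_nhds_bddAbove_norm_iteratedFDeriv_orbFamGExt_of_boxPackage
    {J : Matrix (Fin 2) (Fin 2) ℂ} (hJ : J = (StdForm.antidiagonal 2).over ℂ)
    [MeasurableSpace ↥(unitaryGroupOfForm (starRingEnd ℂ) J)] [BorelSpace ↥(unitaryGroupOfForm (starRingEnd ℂ) J)]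
    [LocallyCompactSpace ↥(unitaryGroupOfForm (starRingEnd ℂ) J)] [SecondCountableTopology ↥(unitaryGroupOfForm (starRingEnd ℂ) J)]
    (μ₀ : Measure ↥(unitaryGroupOfForm (starRingEnd ℂ) J)) [μ₀.IsHaarMeasure] [μ₀.IsMulRightInvariant]
    {S : Finset {w : InfinitePlace L // IsComplex w}} {w₀ : {w : InfinitePlace L // IsComplex w}} {p : {w : InfinitePlace L // IsComplex w} → Fin 3 → ℝ}
    (hw₀ : w₀ ∉ S) (hs : slotSign L α w₀ 0 ≠ slotSign L α w₀ 2) (hx : p w₀ 0 = p w₀ 2) (hxk : Circle.exp (p w₀ (hcThird 0 2)) ≠ Circle.exp (p w₀ 0))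
    (hxin : ∀ w', w' ∉ S → w' ≠ w₀ → ∀ i' j' : Fin 3, i' ≠ j' → slotSign L α w' i' ≠ slotSign L α w' j' → Circle.exp (p w' i') ≠ Circle.exp (p w' j'))
    {a' : ↥(arch (↥(maximalRealSubfield L)) L (IsCMField.complexConj L) 3 (Matrix.diagonal α)) → ℂ}
    (hpack : ∃ (K : ℂ) (U : Set ({w : InfinitePlace L // IsComplex w} → Fin 3 → ℝ)) (f : ({w : InfinitePlace L // IsComplex w} → Fin 3 → ℝ) × Matrix (Fin 2) (Fin 2) ℂ → ℂ),
      K ≠ 0 ∧ IsOpen U ∧ p ∈ U ∧ ContDiff ℝ ∞ f ∧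
      (∃ C : Set (Matrix (Fin 2) (Fin 2) ℂ), IsCompact C ∧ ∀ c X, X ∉ C → f (c, X) = 0) ∧
      (∀ c X, f (c, X) = f (Function.update c w₀ ![0, c w₀ 1, 0], X)) ∧
      (∀ c ∈ U, Circle.exp (c w₀ 0) ≠ Circle.exp (c w₀ 2) → c ∈ InRegG (slotSign L α) S) ∧
      ∀ c ∈ U, Circle.exp (c w₀ 0) ≠ Circle.exp (c w₀ 2) →
        orbFamGExt L α ν' a' S c =
          (1 - (Circle.exp (c w₀ 1 - c w₀ 0) : ℂ)) * (1 - (Circle.exp (c w₀ 2 - c w₀ 0) : ℂ)) * (1 - (Circle.exp (c w₀ 2 - c w₀ 1) : ℂ)) *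
          (K * ∫ h : ↥(unitaryGroupOfForm (starRingEnd ℂ) J),
            f (c, (((h * ⟨Matrix.GeneralLinearGroup.mkOfDetNeZero !![(1 : ℂ), 1; 1, -1] det_cayleyTwo_ne_zero *
                  circleDiagonal 2 ![Circle.exp (c w₀ 0), Circle.exp (c w₀ 2)] *
                  (Matrix.GeneralLinearGroup.mkOfDetNeZero !![(1 : ℂ), 1; 1, -1] det_cayleyTwo_ne_zero)⁻¹,
                cayley_conj_circleDiagonal_mem_of_eq_over hJ _⟩ * h⁻¹ : ↥(unitaryGroupOfForm (starRingEnd ℂ) J)) : GL (Fin 2) ℂ) : Matrix (Fin 2) (Fin 2) ℂ)) ∂μ₀))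
    (n : ℕ) :
    ∃ U ∈ 𝓝 p, BddAbove ((fun c => ‖iteratedFDeriv ℝ n (orbFamGExt L α ν' a' S) c‖) '' (U ∩ InRegG (slotSign L α) S)) := by
  obtain ⟨K, U, f, hK, hUo, hpU, hf, hfC, hft, -, hdesc⟩ := hpack
  -- the Cayley functional at centre `1`
  obtain ⟨F, hF⟩ : ∃ F : (Matrix (Fin 2) (Fin 2) ℂ → ℂ) → ℝ → ℂ, ∀ (g : Matrix (Fin 2) (Fin 2) ℂ → ℂ) (ψ : ℝ), F g ψ = (2 * Real.sin ψ) •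
      ∫ h : ↥(unitaryGroupOfForm (starRingEnd ℂ) J), g (((h * (⟨(Matrix.GeneralLinearGroup.mkOfDetNeZero !![(1 : ℂ), 1; 1, -1] det_cayleyTwo_ne_zero) * circleDiagonal 2 ![1 * Circle.exp ψ, 1 * Circle.exp (-ψ)] * ((Matrix.GeneralLinearGroup.mkOfDetNeZero !![(1 : ℂ), 1; 1, -1] det_cayleyTwo_ne_zero))⁻¹, cayley_conj_circleDiagonal_mem_of_eq_over hJ _⟩ : ↥(unitaryGroupOfForm (starRingEnd ℂ) J)) * h⁻¹ : ↥(unitaryGroupOfForm (starRingEnd ℂ) J)) : GL (Fin 2) ℂ) : Matrix (Fin 2) (Fin 2) ℂ) ∂μ₀ :=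
    ⟨fun g ψ => _, fun _ _ => rfl⟩
  -- the dress of the package
  obtain ⟨K₁, U₁, g, Pf, Ef, -, hU₁o, hpU₁, hgs, hgC, hPf, hEf, -, -, hdesc₁⟩ :=
    exists_wallDescent_dress_of_boxPackage L α ν' hJ μ₀ hw₀ hK hUo hpU hf hfC hft hdesc F hF
  -- the admissible class and its transversal derivatives
  set Adm : (({w : InfinitePlace L // IsComplex w} → Fin 3 → ℝ) → Matrix (Fin 2) (Fin 2) ℂ → ℂ) → Prop := fun Θ =>
    ContDiff ℝ ∞ (uncurry Θ) ∧ ∃ C : Set (Matrix (Fin 2) (Fin 2) ℂ), IsCompact C ∧ ∀ q X, X ∉ C → Θ q X = 0 with hAdm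
  set D : ({w : InfinitePlace L // IsComplex w} → Fin 3 → ℝ) → (({w : InfinitePlace L // IsComplex w} → Fin 3 → ℝ) → Matrix (Fin 2) (Fin 2) ℂ → ℂ) →
      (({w : InfinitePlace L // IsComplex w} → Fin 3 → ℝ) → Matrix (Fin 2) (Fin 2) ℂ → ℂ) := fun v Θ q X => fderiv ℝ (fun q' => Θ q' X) q v with hD
  have hcl : ∀ Θ, Adm Θ → ∀ v, Adm (D v Θ) := by
    rintro Θ ⟨hΘ, C, hC, hΘC⟩ v
    exact ⟨contDiff_uncurry_fderiv_apply hΘ v, C, hC, forall_fderiv_apply_eq_zero_of_support hΘC v⟩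
  have hg : Adm g := ⟨hgs, hgC⟩
  -- the reader clauses on `univ ×ˢ {sin ψ ≠ 0}`
  have hT₁ : IsOpen {ψ : ℝ | Real.sin ψ ≠ 0} := isOpen_ne_fun Real.continuous_sin continuous_const
  have hray : ∀ᶠ t : ℝ in 𝓝[≠] 0, t ∈ {ψ : ℝ | Real.sin ψ ≠ 0} := by
    have h : Ioo (-Real.pi) Real.pi ∩ {(0 : ℝ)}ᶜ ∈ 𝓝[≠] (0 : ℝ) :=
      inter_mem (mem_nhdsWithin_of_mem_nhds (Ioo_mem_nhds (neg_lt_zero.2 Real.pi_pos) Real.pi_pos)) self_mem_nhdsWithin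
    filter_upwards [h] with t ht
    rcases lt_or_gt_of_ne (show t ≠ 0 from ht.2) with hlt | hgt
    · exact (Real.sin_neg_of_neg_of_neg_pi_lt hlt ht.1.1).ne
    · exact (Real.sin_pos_of_pos_of_lt_pi hgt ht.1.2).ne'
  have h1 : ∀ Θ, Adm Θ → ContDiffOn ℝ ∞ (fun z : ({w : InfinitePlace L // IsComplex w} → Fin 3 → ℝ) × ℝ => F (Θ z.1) z.2) ((univ : Set ({w : InfinitePlace L // IsComplex w} → Fin 3 → ℝ)) ×ˢ {ψ : ℝ | Real.sin ψ ≠ 0}) := by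
    rintro Θ ⟨hΘ, hΘC⟩
    exact (contDiffOn_cayley_orbitalIntegral_param hJ μ₀ 1 F hF Θ hΘ hΘC).mono (prod_mono le_rfl le_rfl)
  have h2 : ∀ Θ, Adm Θ → ∀ (v : {w : InfinitePlace L // IsComplex w} → Fin 3 → ℝ) (z : ({w : InfinitePlace L // IsComplex w} → Fin 3 → ℝ) × ℝ), z ∈ (univ : Set ({w : InfinitePlace L // IsComplex w} → Fin 3 → ℝ)) ×ˢ {ψ : ℝ | Real.sin ψ ≠ 0} →
      fderiv ℝ (fun z : ({w : InfinitePlace L // IsComplex w} → Fin 3 → ℝ) × ℝ => F (Θ z.1) z.2) z (v, 0) = F (D v Θ z.1) z.2 := by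
    rintro Θ ⟨hΘ, hΘC⟩ v z hz
    exact fderiv_cayley_orbitalIntegral_param_prod_apply hJ μ₀ 1 F hF Θ hΘ hΘC v hz.2
  -- the (I₁) input: uniform punctured bounds over compact smooth families (frame witness `(L, w₀)`)
  have hbd : ∀ Θ, Adm Θ → ∀ (a : ℕ) (K : Set ({w : InfinitePlace L // IsComplex w} → Fin 3 → ℝ)), IsCompact K → K ⊆ (univ : Set ({w : InfinitePlace L // IsComplex w} → Fin 3 → ℝ)) →
      ∃ B : ℝ, ∀ᶠ ψ in 𝓝[≠] (0 : ℝ), ∀ q ∈ K, ‖iteratedDeriv a (F (Θ q)) ψ‖ ≤ B := by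
    rintro Θ ⟨hΘ, C, hC, hΘC⟩ a K hK -
    exact exists_forall_eventually_norm_iteratedDeriv_orbitalIntegral_cayley_le_of_contDiff_family_of_eq_over L w₀ hJ μ₀ 1 F hF hK Θ hΘ hC hΘC a
  -- the cofactor `2cos` and the head (one-wall edition)
  have hce : ContDiff ℝ ∞ fun ν : ℝ => ((2 * Real.cos ν : ℝ) : ℂ) := Complex.ofRealCLM.contDiff.comp (contDiff_const.mul Real.contDiff_cos)
  exact exists_nhds_bddAbove_norm_iteratedFDeriv_orbFamGExt_of_wallDescent_oneWall L α ν' a' S hw₀ (show (0 : Fin 3) ≠ 2 by decide) hs hx hxk hxin F hT₁ hray Adm D hcl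
    isOpen_univ (mem_univ p) h1 h2 g hg Pf Ef hPf.contDiffOn hEf.contDiffOn (fun ν : ℝ => ((2 * Real.cos ν : ℝ) : ℂ)) hce K₁ hU₁o hpU₁
    (fun c hc hT => hdesc₁ c hc hT) hbd n

end Literature.NumberTheory.Rogawski1990

end
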